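import Summits.Schanuel.Schanuel.Theorems.RootDecomp1KNW96Core04

/-!
# RootDecomp1KNW96Core — lens 6, generation 23 «NW96 THEOREM 1, c = 400, HYPOTHESIS-FREE» (PROGRAMME G23-b; VERDICT L2175: THEOREM ×1): `theorem nw1996MainR_400 : NW1996MainR 400` — Nesterenko–Waldschmidt 1996 Theorem 1 (first assertion) with the absolute constant 400 in place of the printed 211, SORRY-FREE, NO hypothesis, NO named fact; = `core` (parts 01–03) + the glue `mainR_of_paramsOK : ParamsOK c → NW1996MainR c` + the audited repair parameters `paramsOK_400` (S = ⌊25UV⌋, S₁ = ⌊9DW+½⌋, T = ⌊33DVW⌋, T₁ = ⌊5U+½⌋, H = ⌊1.1 W log E⌋, ε = E^{−400DUVW}) — continuation (RootDecomp1KNW96Core05): §5 ParamsB + ParamsC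

(lens-6 g23 HOME kernel g23b/NW96Main.lean 5c2fab87…, 2022 l = NW96Core.lean body byte-identical (ported as parts 01–03) + §4–§6; extra imports Literature PiTranscendenceMeasureMain + PiTranscendenceMeasureParams + ExpLogSimultaneousApproximationMeasure (the def `NW1996MainR`, census p828340); NODE L2171 / REQUEST L2172 / ADDENDUM L2174, writer re-check L2173, critic VERDICT L2175 (CLEARED — THEOREM ×1 (G23-b); lens-6 tally THEOREM ×6 + CELL ×3 + AUDIT ×1; RULE G24; PORT GO priority HIGH, Summit-side first; Literature relocation of `nw1996MainR_400` next to the cite-tagged fact = later census pass); port by census-1 gen 18 as `RootDecomp1KNW96Core04`–`07`: 04 = §4 the glue `ParamsOK`, `mainR_of_paramsOK` + §5 ParamsA; 05 = §5 ParamsB + ParamsC; 06 = §5 ParamsD; 07 = §5 ParamsE (`paramsOK_400`, scoped `maxHeartbeats 1000000` as in K) + §6 the headline `nw1996MainR_400`.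
PORT EDITS: `set_option linter.dupNamespace false` and `import HarnessLib` dropped; parts 01–03 untouched; statements and proofs verbatim. `--supports stmt-Schanuel-33364`; no census credit carried; rung 0 — nothing here proves Schanuel. CONSEQUENCE OF RECORD: the registered fact `NesterenkoWaldschmidt1996_thm_1` (constant 211, PRINT-CLAIM · PROOF-GAP per the g22 audit) now has a PROVED weaker-constant companion in the tree; RULE G24 (critic L2175) governs the consumer re-typing generic in c.)
-/

noncomputable section

open Finset

namespace Summit.Schanuel.Schanuel.Theorems.RootDecomp1KNW96Core

open Literature.NumberTheory.Transcendental

section Params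

open Real

section ParamsB

/-! ### B. The parameters (floors), the counting conditions (2.1), and the size of `L` -/

/-- **The floor bounds** for `T₁ = ⌊5U + ½⌋`, `S₁ = ⌊9DW + ½⌋`, `H = ⌊1.1 Wℓ⌋`, `S = ⌊25UV⌋`,
`T = ⌊33DVW⌋`. [cite: NesterenkoWaldschmidt1996, §6 (6.1); REPAIR-v2 §4] -/
theorem params_floors {D U V W ℓ : ℝ} (hD : 1 ≤ D) (hU : 1 ≤ U) (hV : 6 ≤ V) (hW : 2 ≤ W) (hℓ : 1 ≤ ℓ)
    {T₁ S₁ H S T : ℕ} (hT₁ : T₁ = ⌊5 * U + 1 / 2⌋₊) (hS₁ : S₁ = ⌊9 * D * W + 1 / 2⌋₊)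
    (hH : H = ⌊11 / 10 * (W * ℓ)⌋₊) (hS : S = ⌊25 * U * V⌋₊) (hT : T = ⌊33 * D * V * W⌋₊) :
    ((T₁ : ℝ) ≤ 5 * U + 1 / 2 ∧ 5 * U + 1 / 2 - 1 < (T₁ : ℝ)) ∧
    ((S₁ : ℝ) ≤ 9 * D * W + 1 / 2 ∧ 9 * D * W + 1 / 2 - 1 < (S₁ : ℝ)) ∧
    ((H : ℝ) ≤ 11 / 10 * (W * ℓ) ∧ 11 / 10 * (W * ℓ) - 1 < (H : ℝ)) ∧
    ((S : ℝ) ≤ 25 * U * V ∧ 25 * U * V - 1 < (S : ℝ)) ∧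
    ((T : ℝ) ≤ 33 * D * V * W ∧ 33 * D * V * W - 1 < (T : ℝ)) := by
  have hU0 : 0 ≤ U := by linarith
  have hV0 : 0 ≤ V := by linarith
  have hW0 : 0 ≤ W := by linarith
  have hD0 : 0 ≤ D := by linarith
  have hℓ0 : 0 ≤ ℓ := by linarith
  refine ⟨?_, ?_, ?_, ?_, ?_⟩
  · rw [hT₁]; exact NWPi.floor_facts (by positivity)
  · rw [hS₁]; exact NWPi.floor_facts (by positivity)
  · rw [hH]; exact NWPi.floor_facts (by positivity)
  · rw [hS]; exact NWPi.floor_facts (by positivity)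
  · rw [hT]; exact NWPi.floor_facts (by positivity)

/-- **The counting conditions** (2.1) of Lemma 6 and positivity: `H, T₁, S₁, S ≥ 1`, `2T₁ ≤ S + 1`,
`(2T₁+1)T < (S+1−2T₁)(2S₁+1)` (`330Ψ + 66DVW < 450Ψ − 180DUW − 18DW` by `U ≥ 1`, `V ≥ 6`, `UV ≥ 6`).
[cite: NesterenkoWaldschmidt1996, §6 a), (2.1); REPAIR-v2 §4 (Z)] -/
theorem params_counts {D U V W ℓ : ℝ} (hD : 1 ≤ D) (hU : 1 ≤ U) (hV : 6 ≤ V) (hW : 2 ≤ W) (hℓ : 1 ≤ ℓ)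
    {T₁ S₁ H S T : ℕ} (hT₁ : T₁ = ⌊5 * U + 1 / 2⌋₊) (hS₁ : S₁ = ⌊9 * D * W + 1 / 2⌋₊)
    (hH : H = ⌊11 / 10 * (W * ℓ)⌋₊) (hS : S = ⌊25 * U * V⌋₊) (hT : T = ⌊33 * D * V * W⌋₊) :
    (1 ≤ H ∧ 1 ≤ T₁ ∧ 1 ≤ S₁ ∧ 1 ≤ S) ∧ 2 * T₁ ≤ S + 1 ∧
      (2 * T₁ + 1) * T < (S + 1 - 2 * T₁) * (2 * S₁ + 1) := by
  obtain ⟨⟨hT₁le, hT₁gt⟩, ⟨hS₁le, hS₁gt⟩, ⟨hHle, hHgt⟩, ⟨hSle, hSgt⟩, ⟨hTle, hTgt⟩⟩ :=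
    params_floors hD hU hV hW hℓ hT₁ hS₁ hH hS hT
  have hU0 : 0 ≤ U := by linarith
  have hD0 : 0 ≤ D := by linarith
  have hW0 : 0 ≤ W := by linarith
  have hWℓ : 2 * 1 ≤ W * ℓ := mul_le_mul hW hℓ (by norm_num) hW0
  have hDW : 1 * 2 ≤ D * W := mul_le_mul hD hW (by norm_num) hD0
  have hUV : 1 * 6 ≤ U * V := mul_le_mul hU hV (by norm_num) hU0
  have h1 : 1 ≤ H := by
    have h : ((1 : ℕ) : ℝ) ≤ H := by rw [Nat.cast_one]; linarith
    exact Nat.cast_le.mp h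
  have h2 : 1 ≤ T₁ := by
    have h : ((1 : ℕ) : ℝ) ≤ T₁ := by rw [Nat.cast_one]; linarith
    exact Nat.cast_le.mp h
  have h3 : 1 ≤ S₁ := by
    have h : ((1 : ℕ) : ℝ) ≤ S₁ := by rw [Nat.cast_one]; linarith
    exact Nat.cast_le.mp h
  have hUV' : 25 * U * 6 ≤ 25 * U * V := mul_le_mul_of_nonneg_left hV (by linarith)
  have h4 : 1 ≤ S := by
    have h : ((1 : ℕ) : ℝ) ≤ S := by rw [Nat.cast_one]; linarith
    exact Nat.cast_le.mp h
  have h5r : (2 : ℝ) * T₁ < S + 1 := by linarith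
  have h5 : 2 * T₁ ≤ S + 1 := by
    have h : ((2 * T₁ : ℕ) : ℝ) < ((S + 1 : ℕ) : ℝ) := by
      rw [Nat.cast_mul, Nat.cast_add, Nat.cast_two, Nat.cast_one]; exact h5r
    exact (Nat.cast_lt.mp h).le
  refine ⟨⟨h1, h2, h3, h4⟩, h5, ?_⟩
  -- the count in `ℝ`, `Ψ = DUVW`
  have hΨ0 : 0 ≤ D * U * V * W := by positivity
  have hDVW0 : 0 ≤ D * V * W := by positivity
  have hA : D * V * W ≤ D * U * V * W := by
    have := mul_le_mul_of_nonneg_left hU hDVW0; linarith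
  have hB : 6 * (D * U * W) ≤ D * U * V * W := by
    have := mul_le_mul_of_nonneg_left hV (by positivity : 0 ≤ D * U * W); linarith
  have hC : 6 * (D * W) ≤ D * U * V * W := by
    have := mul_le_mul_of_nonneg_left hUV (by positivity : 0 ≤ D * W); linarith
  have hlhs : ((2 * T₁ + 1 : ℕ) : ℝ) * T ≤ 330 * (D * U * V * W) + 66 * (D * V * W) := by
    push_cast
    have ha : (2 : ℝ) * T₁ + 1 ≤ 10 * U + 2 := by linarith
    have hb : (0 : ℝ) ≤ T := Nat.cast_nonneg _
    have hc : ((2 : ℝ) * T₁ + 1) * T ≤ (10 * U + 2) * (33 * D * V * W) :=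
      mul_le_mul ha hTle hb (by positivity)
    have e : (10 * U + 2) * (33 * D * V * W) = 330 * (D * U * V * W) + 66 * (D * V * W) := by ring
    linarith
  have hrhs : 450 * (D * U * V * W) - 180 * (D * U * W) - 18 * (D * W) ≤
      ((S + 1 - 2 * T₁ : ℕ) : ℝ) * ((2 * S₁ + 1 : ℕ) : ℝ) := by
    rw [Nat.cast_sub h5]
    push_cast
    have ha : 25 * U * V - 10 * U - 1 ≤ (S : ℝ) + 1 - 2 * T₁ := by linarith
    have ha0 : 0 ≤ 25 * U * V - 10 * U - 1 := by linarith
    have hb : 18 * D * W ≤ 2 * (S₁ : ℝ) + 1 := by linarith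
    have hc : (25 * U * V - 10 * U - 1) * (18 * D * W) ≤ ((S : ℝ) + 1 - 2 * T₁) * (2 * S₁ + 1) :=
      mul_le_mul ha hb (by positivity) (by linarith)
    have e : (25 * U * V - 10 * U - 1) * (18 * D * W) =
        450 * (D * U * V * W) - 180 * (D * U * W) - 18 * (D * W) := by ring
    linarith
  have hmid : 330 * (D * U * V * W) + 66 * (D * V * W) <
      450 * (D * U * V * W) - 180 * (D * U * W) - 18 * (D * W) := by
    have hpos : (1 * 2) * (1 * 6) ≤ (D * W) * (U * V) := mul_le_mul hDW hUV (by norm_num) (by linarith)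
    have e : (D * W) * (U * V) = D * U * V * W := by ring
    rw [e] at hpos
    linarith
  have key : (((2 * T₁ + 1) * T : ℕ) : ℝ) < (((S + 1 - 2 * T₁) * (2 * S₁ + 1) : ℕ) : ℝ) := by
    rw [Nat.cast_mul, Nat.cast_mul]
    exact lt_of_le_of_lt hlhs (hmid.trans_le hrhs)
  exact Nat.cast_lt.mp key

/-- **The size of `L = (T+1)(2T₁+1)` and the width bound**: `330Ψ < L ≤ 397Ψ` (`Ψ = DUVW`),
`2m ≤ L S₁(T₁ + ½)` for `m = S₁(T+1)T₁(T₁+1)`, and `N = T₁S₁ ≤ 8.5Ψ`.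
[cite: NesterenkoWaldschmidt1996, §6 (6.4); REPAIR-v2 §4 (E)] -/
theorem params_L {D U V W ℓ : ℝ} (hD : 1 ≤ D) (hU : 1 ≤ U) (hV : 6 ≤ V) (hW : 2 ≤ W) (hℓ : 1 ≤ ℓ)
    {T₁ S₁ H S T L m : ℕ} (hT₁ : T₁ = ⌊5 * U + 1 / 2⌋₊) (hS₁ : S₁ = ⌊9 * D * W + 1 / 2⌋₊)
    (hH : H = ⌊11 / 10 * (W * ℓ)⌋₊) (hS : S = ⌊25 * U * V⌋₊) (hT : T = ⌊33 * D * V * W⌋₊)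
    (hL : L = (T + 1) * (2 * T₁ + 1)) (hm : m = S₁ * (T + 1) * (T₁ * (T₁ + 1))) :
    330 * (D * U * V * W) < L ∧ (L : ℝ) ≤ 397 * (D * U * V * W) ∧
      2 * (m : ℝ) ≤ (L : ℝ) * ((S₁ : ℝ) * ((T₁ : ℝ) + 1 / 2)) ∧
      ((T₁ * S₁ : ℕ) : ℝ) ≤ 8.5 * (D * U * V * W) ∧ (S : ℝ) ≤ 12.5 * (D * U * V * W) := by
  obtain ⟨⟨hT₁le, hT₁gt⟩, ⟨hS₁le, hS₁gt⟩, ⟨hHle, hHgt⟩, ⟨hSle, hSgt⟩, ⟨hTle, hTgt⟩⟩ :=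
    params_floors hD hU hV hW hℓ hT₁ hS₁ hH hS hT
  have hU0 : 0 ≤ U := by linarith
  have hD0 : 0 ≤ D := by linarith
  have hW0 : 0 ≤ W := by linarith
  have hV0 : 0 ≤ V := by linarith
  have hDW : 1 * 2 ≤ D * W := mul_le_mul hD hW (by norm_num) hD0
  have hUV : 1 * 6 ≤ U * V := mul_le_mul hU hV (by norm_num) hU0
  have hLr : (L : ℝ) = ((T : ℝ) + 1) * (2 * T₁ + 1) := by rw [hL]; push_cast; ring
  have hmr : (m : ℝ) = (S₁ : ℝ) * ((T : ℝ) + 1) * ((T₁ : ℝ) * ((T₁ : ℝ) + 1)) := by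
    rw [hm]; push_cast; ring
  have hΨ0 : 0 ≤ D * U * V * W := by positivity
  have hDVW : D * V * W ≤ D * U * V * W := by
    have := mul_le_mul_of_nonneg_left hU (by positivity : 0 ≤ D * V * W); linarith
  have hDVW12 : 12 ≤ D * V * W := by
    have h1 : 1 * 6 ≤ D * V := mul_le_mul hD hV (by norm_num) hD0
    have := mul_le_mul h1 hW (by norm_num) (by positivity)
    linarith
  have hUΨ : 12 * U ≤ D * U * V * W := by
    have := mul_le_mul_of_nonneg_left hDVW12 hU0; linarith
  have hlow : 330 * (D * U * V * W) < L := by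
    rw [hLr]
    have ha : 33 * D * V * W < (T : ℝ) + 1 := by linarith
    have hb : 10 * U < 2 * (T₁ : ℝ) + 1 := by linarith
    have hc : (33 * D * V * W) * (10 * U) < ((T : ℝ) + 1) * (2 * T₁ + 1) :=
      mul_lt_mul'' ha hb (by positivity) (by positivity)
    have e : (33 * D * V * W) * (10 * U) = 330 * (D * U * V * W) := by ring
    linarith
  have hhigh : (L : ℝ) ≤ 397 * (D * U * V * W) := by
    rw [hLr]
    have ha : (T : ℝ) + 1 ≤ 33 * D * V * W + 1 := by linarith
    have hb : 2 * (T₁ : ℝ) + 1 ≤ 10 * U + 2 := by linarith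
    have hc : ((T : ℝ) + 1) * (2 * T₁ + 1) ≤ (33 * D * V * W + 1) * (10 * U + 2) :=
      mul_le_mul ha hb (by positivity) (by positivity)
    have e : (33 * D * V * W + 1) * (10 * U + 2) =
        330 * (D * U * V * W) + 66 * (D * V * W) + 10 * U + 2 := by ring
    linarith
  have hT₁0 : (0 : ℝ) ≤ T₁ := Nat.cast_nonneg _
  have hS₁0 : (0 : ℝ) ≤ S₁ := Nat.cast_nonneg _
  have hT0 : (0 : ℝ) ≤ T := Nat.cast_nonneg _
  refine ⟨hlow, hhigh, ?_, ?_, ?_⟩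
  · have h1 : 2 * ((T₁ : ℝ) * ((T₁ : ℝ) + 1)) ≤ (2 * (T₁ : ℝ) + 1) * ((T₁ : ℝ) + 1 / 2) := by nlinarith
    have h2 : 0 ≤ (S₁ : ℝ) * ((T : ℝ) + 1) := by positivity
    have h3 := mul_le_mul_of_nonneg_left h1 h2
    have e1 : 2 * (m : ℝ) = (S₁ : ℝ) * ((T : ℝ) + 1) * (2 * ((T₁ : ℝ) * ((T₁ : ℝ) + 1))) := by
      rw [hmr]; ring
    have e2 : (L : ℝ) * ((S₁ : ℝ) * ((T₁ : ℝ) + 1 / 2)) =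
        (S₁ : ℝ) * ((T : ℝ) + 1) * ((2 * (T₁ : ℝ) + 1) * ((T₁ : ℝ) + 1 / 2)) := by
      rw [hLr]; ring
    rw [e1, e2]; exact h3
  · push_cast
    have h1 : (T₁ : ℝ) * S₁ ≤ (5 * U + 1 / 2) * (9 * D * W + 1 / 2) := mul_le_mul hT₁le hS₁le hS₁0 (by positivity)
    have h2 : (5 * U + 1 / 2) * (9 * D * W + 1 / 2) ≤ (11 / 2 * U) * (37 / 4 * (D * W)) := by
      apply mul_le_mul <;> linarith [hDW]
    have h3 : 6 * (D * U * W) ≤ D * U * V * W := by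
      have := mul_le_mul_of_nonneg_left hV (by positivity : 0 ≤ D * U * W); linarith
    have e : (11 / 2 * U) * (37 / 4 * (D * W)) = 407 / 8 * (D * U * W) := by ring
    linarith
  · have h3 : 2 * (U * V) ≤ D * U * V * W := by
      have := mul_le_mul_of_nonneg_left hDW (by positivity : 0 ≤ U * V); linarith
    linarith

end ParamsB

section ParamsC

/-! ### C. The error `ε = exp(−X)`, `X ≥ 400Ψℓ`: the radii `R = max(1,r) + 1`, `B = e^r (1 + 1/(2N+2))` -/

/-- `x ^ n = exp(n log x)` for `x > 0`. [folklore] -/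
theorem pow_eq_exp_mul_log {x : ℝ} (hx : 0 < x) (n : ℕ) : x ^ n = exp ((n : ℝ) * log x) := by
  rw [← Real.log_pow, Real.exp_log (pow_pos hx n)]

/-- **The error is tiny.** With `Ψ ≥ 12`, `ℓ ≥ 1`, `X ≥ 400Ψℓ`, `0 ≤ r`, `2Er ≤ Vℓ`, `2V ≤ Ψ`,
`1 ≤ N ≤ 8.5Ψ`: `ε e^r (2N+3) ≤ 1` (`ε = exp(−X)`), hence `ε ≤ 1`, `ε < e^{−r}`, and for
`B = e^r(1 + 1/(2N+2))`: `e^r + ε ≤ B`, `(e^{−r} − ε)⁻¹ ≤ B`, `0 < B`, `0 ≤ log B ≤ r + 1/(2N+2)`.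
[cite: NesterenkoWaldschmidt1996, §6 b); REPAIR-v2 §4] -/
theorem eps_facts {P ℓ X r E V N : ℝ} (hP : 12 ≤ P) (hℓ : 1 ≤ ℓ) (hX : 400 * P * ℓ ≤ X) (hr : 0 ≤ r)
    (hE : 2.718 ≤ E) (hVr : 2 * E * r ≤ V * ℓ) (hVP : 2 * V ≤ P) (hN0 : 1 ≤ N) (hN : N ≤ 8.5 * P) :
    exp (-X) * exp r * (2 * N + 3) ≤ 1 ∧ exp (-X) ≤ 1 ∧ exp (-X) < exp (-r) ∧
    exp r + exp (-X) ≤ exp r * (1 + 1 / (2 * N + 2)) ∧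
    (exp (-r) - exp (-X))⁻¹ ≤ exp r * (1 + 1 / (2 * N + 2)) ∧
    (0 < exp r * (1 + 1 / (2 * N + 2)) ∧ 0 ≤ log (exp r * (1 + 1 / (2 * N + 2))) ∧
      log (exp r * (1 + 1 / (2 * N + 2))) ≤ r + 1 / (2 * N + 2)) := by
  have hPℓ : 12 ≤ P * ℓ := by nlinarith
  have hVℓ : V * ℓ ≤ P / 2 * ℓ := mul_le_mul_of_nonneg_right (by linarith) (by linarith)
  have hrE : r ≤ E * r := le_mul_of_one_le_left hr (by linarith)
  have hr4 : r ≤ P * ℓ / 4 := by linarith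
  have h23 : 0 < 2 * N + 3 := by linarith
  have hlog23 : log (2 * N + 3) ≤ 2 * N + 3 - 1 := Real.log_le_sub_one_of_pos h23
  have hN' : 2 * N + 3 ≤ 69 / 4 * (P * ℓ) := by nlinarith
  have hkey : exp (-X) * exp r * (2 * N + 3) ≤ 1 := by
    calc exp (-X) * exp r * (2 * N + 3) = exp (-X + r + log (2 * N + 3)) := by
          rw [Real.exp_add, Real.exp_add, Real.exp_log h23]
      _ ≤ exp 0 := Real.exp_le_exp.mpr (by linarith)
      _ = 1 := Real.exp_zero
  have hε1 : exp (-X) ≤ 1 := by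
    rw [← Real.exp_zero]; exact Real.exp_le_exp.mpr (by linarith)
  have hε2 : exp (-X) < exp (-r) := Real.exp_lt_exp.mpr (by linarith)
  have her1 : 1 ≤ exp r := Real.one_le_exp hr
  have hε0 : 0 < exp (-X) := Real.exp_pos _
  have h22 : 0 < 2 * N + 2 := by linarith
  set B := exp r * (1 + 1 / (2 * N + 2)) with hBdef
  have hB0 : 0 < B := by positivity
  have hc4 : exp r + exp (-X) ≤ B := by
    have h1 : exp (-X) * (2 * N + 2) ≤ exp r := by
      have h2 : exp (-X) * (2 * N + 2) ≤ exp (-X) * exp r * (2 * N + 3) := by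
        have h3 : exp (-X) * (2 * N + 2) ≤ exp (-X) * (2 * N + 3) := by nlinarith
        have h4 : exp (-X) * (2 * N + 3) ≤ exp (-X) * (2 * N + 3) * exp r :=
          le_mul_of_one_le_right (by positivity) her1
        nlinarith
      linarith
    have h2 : exp (-X) ≤ exp r / (2 * N + 2) := by rw [le_div_iff₀ h22]; exact h1
    have e : B = exp r + exp r / (2 * N + 2) := by rw [hBdef]; ring
    rw [e]; linarith
  have hc5 : (exp (-r) - exp (-X))⁻¹ ≤ B := by
    have ha : 0 < exp (-r) - exp (-X) := by linarith
    apply inv_le_of_inv_le₀ hB0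
    -- `B⁻¹ = e^{-r} (2N+2)/(2N+3) ≤ e^{-r} - ε`
    have h1 : exp (-X) * (2 * N + 3) ≤ exp (-r) := by
      have h2 : exp (-X) * (2 * N + 3) = exp (-X) * exp r * (2 * N + 3) * exp (-r) := by
        have : exp r * exp (-r) = 1 := by rw [← Real.exp_add, add_neg_cancel, Real.exp_zero]
        calc exp (-X) * (2 * N + 3) = exp (-X) * (2 * N + 3) * (exp r * exp (-r)) := by rw [this, mul_one]
          _ = _ := by ring
      rw [h2]
      have h3 := mul_le_mul_of_nonneg_right hkey (Real.exp_pos (-r)).le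
      linarith
    have hBinv : B⁻¹ = exp (-r) * ((2 * N + 2) / (2 * N + 3)) := by
      rw [hBdef, mul_inv, Real.exp_neg]
      congr 1
      rw [inv_eq_iff_eq_inv, inv_div]
      field_simp
      ring
    rw [hBinv]
    have h4 : exp (-r) * ((2 * N + 2) / (2 * N + 3)) = exp (-r) - exp (-r) / (2 * N + 3) := by
      field_simp; ring
    rw [h4]
    have h5 : exp (-X) ≤ exp (-r) / (2 * N + 3) := by rw [le_div_iff₀ h23]; exact h1
    linarith
  have hlogB : log B = r + log (1 + 1 / (2 * N + 2)) := by
    rw [hBdef, Real.log_mul (Real.exp_pos r).ne' (by positivity), Real.log_exp]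
  have hlog1 : log (1 + 1 / (2 * N + 2)) ≤ 1 / (2 * N + 2) := by
    have := Real.log_le_sub_one_of_pos (by positivity : (0 : ℝ) < 1 + 1 / (2 * N + 2)); linarith
  have hB1 : 1 ≤ B := by
    rw [hBdef]
    have : (1 : ℝ) ≤ 1 + 1 / (2 * N + 2) := by
      have : (0 : ℝ) ≤ 1 / (2 * N + 2) := by positivity
      linarith
    nlinarith
  exact ⟨hkey, hε1, hε2, hc4, hc5, hB0, Real.log_nonneg hB1, by rw [hlogB]; linarith⟩

/-- **The analytic majorant `M`** (the `hMf` conjunct, with equality): the product is `exp` of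
`M = S log S + (T+H) + T log(1 + E S₁/H) + S log(R T₁) + r T₁ E S₁`. [folklore] -/
theorem bigM_eq {S T T₁ S₁ H : ℕ} {E R r : ℝ} (hS : 1 ≤ S) (hT₁ : 1 ≤ T₁) (hH : 1 ≤ H) (hE : 0 < E)
    (hR : 0 < R) :
    (S : ℝ) ^ S * exp ((T : ℝ) + H) * (1 + E * S₁ / H) ^ T * (R * T₁) ^ S * exp (r * T₁ * (E * S₁)) =
      exp ((S : ℝ) * log S + ((T : ℝ) + H) + T * log (1 + E * S₁ / H) + S * log (R * T₁) +
        r * T₁ * (E * S₁)) := by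
  have hS0 : (0 : ℝ) < S := by exact_mod_cast hS
  have hT₁0 : (0 : ℝ) < T₁ := by exact_mod_cast hT₁
  have hH0 : (0 : ℝ) < H := by exact_mod_cast hH
  have h1 : (0 : ℝ) < 1 + E * S₁ / H := by positivity
  have h2 : (0 : ℝ) < R * T₁ := by positivity
  rw [pow_eq_exp_mul_log hS0, pow_eq_exp_mul_log h1, pow_eq_exp_mul_log h2]
  simp only [← Real.exp_add]

/-- **The perturbation majorant** (the `hMp` conjunct): with `(S + N)ε` in place of the perturbation,
`log B ≤ r + 1/(2N+2)`, `R ≥ 1`, `E ≥ 2.718`, `X ≥ 400Ψℓ ≥ Lℓ + 3Ψℓ`, `S ≤ 12.5Ψ`, `N ≤ 8.5Ψ`: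
`𝔓₀ · R^S B^{N+1} (S+N) ε · E^L ≤ exp M`. [cite: NesterenkoWaldschmidt1996, §6 b); REPAIR-v2 §4 (E)] -/
theorem params_small {S T T₁ S₁ H L : ℕ} {E R B r X P ℓ : ℝ} (hS : 1 ≤ S) (hT₁ : 1 ≤ T₁) (hS₁ : 1 ≤ S₁)
    (hH : 1 ≤ H) (hE : 2.718 ≤ E) (hℓ : ℓ = log E) (hℓ1 : 1 ≤ ℓ) (hP : 12 ≤ P) (hX : 400 * P * ℓ ≤ X)
    (hr : 0 ≤ r) (hR : 1 ≤ R) (hB0 : 0 < B) (hlogB : log B ≤ r + 1 / (2 * ((T₁ * S₁ : ℕ) : ℝ) + 2))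
    (hSP : (S : ℝ) ≤ 12.5 * P) (hNP : ((T₁ * S₁ : ℕ) : ℝ) ≤ 8.5 * P) (hLP : (L : ℝ) ≤ 397 * P) :
    (S : ℝ) ^ S * exp ((T : ℝ) + H) * (1 + (S₁ : ℝ) / H) ^ T * (T₁ : ℝ) ^ S *
        (R ^ S * B ^ (T₁ * S₁ + 1) * (((S : ℝ) + ((T₁ * S₁ : ℕ) : ℝ)) * exp (-X))) * E ^ L ≤
      exp ((S : ℝ) * log S + ((T : ℝ) + H) + T * log (1 + E * S₁ / H) + S * log (R * T₁) +
        r * T₁ * (E * S₁)) := by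
  have hS0 : (0 : ℝ) < S := by exact_mod_cast hS
  have hT₁0 : (0 : ℝ) < T₁ := by exact_mod_cast hT₁
  have hT₁1 : (1 : ℝ) ≤ T₁ := by exact_mod_cast hT₁
  have hS₁1 : (1 : ℝ) ≤ S₁ := by exact_mod_cast hS₁
  have hH0 : (0 : ℝ) < H := by exact_mod_cast hH
  have hE0 : 0 < E := by linarith
  have hR0 : 0 < R := by linarith
  set N : ℝ := ((T₁ * S₁ : ℕ) : ℝ) with hNdef
  have hNr : N = (T₁ : ℝ) * S₁ := by rw [hNdef]; push_cast; ring
  have hN1 : 1 ≤ N := by rw [hNr]; nlinarith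
  have hSN : 0 < (S : ℝ) + N := by linarith
  have h1 : (0 : ℝ) < 1 + (S₁ : ℝ) / H := by positivity
  have hE' : (0 : ℝ) < 1 + E * S₁ / H := by positivity
  -- write the left side as one exponential
  have hlhs : (S : ℝ) ^ S * exp ((T : ℝ) + H) * (1 + (S₁ : ℝ) / H) ^ T * (T₁ : ℝ) ^ S *
        (R ^ S * B ^ (T₁ * S₁ + 1) * (((S : ℝ) + N) * exp (-X))) * E ^ L =
      exp ((S : ℝ) * log S + ((T : ℝ) + H) + T * log (1 + (S₁ : ℝ) / H) + S * log T₁ +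
        (S * log R + ((T₁ * S₁ + 1 : ℕ) : ℝ) * log B + (log ((S : ℝ) + N) + -X)) + L * log E) := by
    rw [pow_eq_exp_mul_log hS0, pow_eq_exp_mul_log h1, pow_eq_exp_mul_log hT₁0, pow_eq_exp_mul_log hR0,
      pow_eq_exp_mul_log hB0, pow_eq_exp_mul_log hE0, ← Real.exp_log hSN]
    simp only [← Real.exp_add, Real.log_exp]
  rw [hlhs, Real.exp_le_exp]
  -- compare the exponents
  have hlogmono : log (1 + (S₁ : ℝ) / H) ≤ log (1 + E * S₁ / H) := by
    apply Real.log_le_log h1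
    have : (S₁ : ℝ) / H ≤ E * S₁ / H := by
      rw [mul_div_assoc]; exact le_mul_of_one_le_left (by positivity) (by linarith)
    linarith
  have hT0 : (0 : ℝ) ≤ T := Nat.cast_nonneg _
  have hA : (T : ℝ) * log (1 + (S₁ : ℝ) / H) ≤ T * log (1 + E * S₁ / H) :=
    mul_le_mul_of_nonneg_left hlogmono hT0
  have hRT : log (R * T₁) = log R + log T₁ := Real.log_mul hR0.ne' hT₁0.ne'
  have hNcast : ((T₁ * S₁ + 1 : ℕ) : ℝ) = N + 1 := by rw [hNdef]; push_cast; ring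
  have hBb : (N + 1) * log B ≤ (N + 1) * r + 1 / 2 := by
    have h2 : (N + 1) * log B ≤ (N + 1) * (r + 1 / (2 * N + 2)) :=
      mul_le_mul_of_nonneg_left hlogB (by linarith)
    have e : (N + 1) * (r + 1 / (2 * N + 2)) = (N + 1) * r + 1 / 2 := by
      have h22 : 2 * N + 2 ≠ 0 := by positivity
      field_simp
    linarith
  have hC : (N + 1) * r ≤ r * T₁ * (E * S₁) := by
    have e : r * T₁ * (E * S₁) = (N * E) * r := by rw [hNr]; ring
    rw [e]
    have : N + 1 ≤ N * E := by nlinarith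
    exact mul_le_mul_of_nonneg_right this hr
  have hPℓ : 12 ≤ P * ℓ := by
    have := mul_le_mul hP hℓ1 zero_le_one (by linarith); linarith
  have hSNle : (S : ℝ) + N ≤ 21 * (P * ℓ) := by
    have : P ≤ P * ℓ := le_mul_of_one_le_right (by linarith) hℓ1
    linarith
  have hlogSN : log ((S : ℝ) + N) ≤ P * ℓ + 6.77 := by
    have h2 : log ((S : ℝ) + N) ≤ log (21 * (P * ℓ)) := Real.log_le_log hSN hSNle
    rw [Real.log_mul (by norm_num) (by positivity)] at h2
    have h3 : log 21 ≤ 0.37 * 21 := log_le_mul (by norm_num)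
    have h4 : log (P * ℓ) ≤ P * ℓ - 1 := Real.log_le_sub_one_of_pos (by positivity)
    linarith
  have hLℓ : (L : ℝ) * log E ≤ 397 * P * ℓ := by
    rw [← hℓ]
    have := mul_le_mul_of_nonneg_right hLP (by linarith : (0 : ℝ) ≤ ℓ)
    linarith
  rw [hNcast, hRT]
  linarith [hA, hBb, hC, hlogSN, hLℓ, hX, hPℓ]

end ParamsC

end Params

end Summit.Schanuel.Schanuel.Theorems.RootDecomp1KNW96Core

end
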